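import Summits.Ventures.HodgeRepro2.T5SU11JacobiPhaseOrbitCorrelationZero

/-!
# The weight-`3` dossier, VI: the covariance of the phase and the orbit radius at the owner's weight `k = 3`

The sixth dossier specialises the covariance chapter (`T5SU11JacobiPhaseOrbitCovariance`,
`T5SU11JacobiPhaseOrbitCorrelationZero`) to `k = 3`, on the strip `−1 < λ < 3`, for the probability measure
`m_3 φ_λ dν/m̂_3(λ)` of the explicit model `π₃⁺`:

* `r_3(λ) = (3 − λ)(1 + λ)/9` (`weightRatio_three`), so
  **`Cov_{3,λ}(log|a|, |g·0|²) = ((3 − λ)(1 + λ)/9) (⟨log|a|⟩_{3,λ} − ⟨log|a|⟩_{5,λ}) ≥ 0`**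
  (`covariance_phase_orbit_sq_three`, `covariance_phase_orbit_sq_three_nonneg`), the mean phase at weight `5`
  not exceeding the one at weight `3` (`mean_phase_five_le_three`);
* at the owner's `λ = 1`: `Cov_{3,1}(log|a|, |g·0|²) = (4/9)(⟨log|a|⟩_{3,1} − ⟨log|a|⟩_{5,1})` (`covariance_phase_orbit_sq_three_one`);
* at `λ = 0`: `Cov_{3,0} = 2/9` and the correlation coefficient `ρ_3(0) = √5/3` (`covariance_phase_orbit_sq_three_zero`,
  `correlation_phase_orbit_sq_three_zero`).

Nothing is claimed about (N).

Blind lane: Mathlib + the HodgeRepro2 prefix only; no sorry; axioms ⊆ {propext, Classical.choice,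
Quot.sound}.
-/

namespace Summit.Ventures.HodgeRepro2.T5SU11WeightThreeDossierVI

open MeasureTheory MeasureTheory.Measure Metric Set Filter Topology
open T5SU11Unimodular T5SU11Fibration T5SU11Cartan T5SU11CartanProjection T5HaarCircle T5BergmanCoefficient
  T5SU11FibrationHaar T5SU11SphericalFunction T5SU11SphericalSymmetry T5SU11SphericalBounds
  T5SU11SphericalContinuous T5SU11JacobiIwasawa T5SU11JacobiTransform T5SU11JacobiWeight
  T5SU11KFiniteMajorantPow T5SU11JacobiWeightDeriv T5SU11JacobiWeightRecursion T5SU11JacobiPhaseMGF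
  T5SU11JacobiPhaseMoments T5SU11JacobiPhaseOrbitCovariance T5SU11JacobiPhaseOrbitCorrelationZero
open scoped Real

/-- `r_3(λ) = (3 − λ)(1 + λ)/9`. -/
theorem weightRatio_three (lam : ℝ) : weightRatio 3 lam = (3 - lam) * (1 + lam) / 9 := by
  rw [weightRatio_eq (by norm_num)]
  ring

section measure

variable [MeasurableSpace Circle] [BorelSpace Circle]

/-- **The mean phase at weight `5` does not exceed the one at weight `3`** on the strip `−1 < λ < 3`. -/
theorem mean_phase_five_le_three {lam : ℝ} (h1 : -1 < lam) (h2 : lam < 3) :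
    (∫ g, Real.log ‖mat g 0 0‖ * ((1 - ‖orbit g‖ ^ 2) ^ ((3 + 2 : ℝ) / 2) * sph lam g) ∂(nu haarCircle))
        / ∫ g, (1 - ‖orbit g‖ ^ 2) ^ ((3 + 2 : ℝ) / 2) * sph lam g ∂(nu haarCircle)
      ≤ (∫ g, Real.log ‖mat g 0 0‖ * ((1 - ‖orbit g‖ ^ 2) ^ ((3 : ℝ) / 2) * sph lam g) ∂(nu haarCircle))
        / ∫ g, (1 - ‖orbit g‖ ^ 2) ^ ((3 : ℝ) / 2) * sph lam g ∂(nu haarCircle) :=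
  mean_phase_antitone (k₁ := 3) (by norm_num) h2 (by linarith) (by norm_num)

/-- **`Cov_{3,λ}(log|a|, |g·0|²) = ((3 − λ)(1 + λ)/9)(⟨log|a|⟩_{3,λ} − ⟨log|a|⟩_{5,λ})`** on the strip `−1 < λ < 3`. -/
theorem covariance_phase_orbit_sq_three {lam : ℝ} (h1 : -1 < lam) (h2 : lam < 3) :
    (∫ g, Real.log ‖mat g 0 0‖ * ‖orbit g‖ ^ 2 * ((1 - ‖orbit g‖ ^ 2) ^ ((3 : ℝ) / 2) * sph lam g)
          ∂(nu haarCircle))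
        / (∫ g, (1 - ‖orbit g‖ ^ 2) ^ ((3 : ℝ) / 2) * sph lam g ∂(nu haarCircle))
      - ((∫ g, Real.log ‖mat g 0 0‖ * ((1 - ‖orbit g‖ ^ 2) ^ ((3 : ℝ) / 2) * sph lam g) ∂(nu haarCircle))
          / (∫ g, (1 - ‖orbit g‖ ^ 2) ^ ((3 : ℝ) / 2) * sph lam g ∂(nu haarCircle)))
        * ((∫ g, ‖orbit g‖ ^ 2 * ((1 - ‖orbit g‖ ^ 2) ^ ((3 : ℝ) / 2) * sph lam g) ∂(nu haarCircle))
          / (∫ g, (1 - ‖orbit g‖ ^ 2) ^ ((3 : ℝ) / 2) * sph lam g ∂(nu haarCircle)))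
      = (3 - lam) * (1 + lam) / 9
        * ((∫ g, Real.log ‖mat g 0 0‖ * ((1 - ‖orbit g‖ ^ 2) ^ ((3 : ℝ) / 2) * sph lam g) ∂(nu haarCircle))
            / (∫ g, (1 - ‖orbit g‖ ^ 2) ^ ((3 : ℝ) / 2) * sph lam g ∂(nu haarCircle))
          - (∫ g, Real.log ‖mat g 0 0‖ * ((1 - ‖orbit g‖ ^ 2) ^ ((3 + 2 : ℝ) / 2) * sph lam g)
              ∂(nu haarCircle))
            / (∫ g, (1 - ‖orbit g‖ ^ 2) ^ ((3 + 2 : ℝ) / 2) * sph lam g ∂(nu haarCircle))) := by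
  rw [covariance_phase_orbit_sq_eq (k := 3) (by norm_num) h2 (by linarith), weightRatio_three]

/-- **`Cov_{3,λ}(log|a|, |g·0|²) ≥ 0`** on the strip `−1 < λ < 3`. -/
theorem covariance_phase_orbit_sq_three_nonneg {lam : ℝ} (h1 : -1 < lam) (h2 : lam < 3) :
    0 ≤ (∫ g, Real.log ‖mat g 0 0‖ * ‖orbit g‖ ^ 2 * ((1 - ‖orbit g‖ ^ 2) ^ ((3 : ℝ) / 2) * sph lam g)
          ∂(nu haarCircle))
        / (∫ g, (1 - ‖orbit g‖ ^ 2) ^ ((3 : ℝ) / 2) * sph lam g ∂(nu haarCircle))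
      - ((∫ g, Real.log ‖mat g 0 0‖ * ((1 - ‖orbit g‖ ^ 2) ^ ((3 : ℝ) / 2) * sph lam g) ∂(nu haarCircle))
          / (∫ g, (1 - ‖orbit g‖ ^ 2) ^ ((3 : ℝ) / 2) * sph lam g ∂(nu haarCircle)))
        * ((∫ g, ‖orbit g‖ ^ 2 * ((1 - ‖orbit g‖ ^ 2) ^ ((3 : ℝ) / 2) * sph lam g) ∂(nu haarCircle))
          / (∫ g, (1 - ‖orbit g‖ ^ 2) ^ ((3 : ℝ) / 2) * sph lam g ∂(nu haarCircle))) :=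
  covariance_phase_orbit_sq_nonneg (k := 3) (by norm_num) h2 (by linarith)

/-- **At the owner's `λ = 1`**: `Cov_{3,1}(log|a|, |g·0|²) = (4/9)(⟨log|a|⟩_{3,1} − ⟨log|a|⟩_{5,1})`. -/
theorem covariance_phase_orbit_sq_three_one :
    (∫ g, Real.log ‖mat g 0 0‖ * ‖orbit g‖ ^ 2 * ((1 - ‖orbit g‖ ^ 2) ^ ((3 : ℝ) / 2) * sph 1 g)
          ∂(nu haarCircle))
        / (∫ g, (1 - ‖orbit g‖ ^ 2) ^ ((3 : ℝ) / 2) * sph 1 g ∂(nu haarCircle))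
      - ((∫ g, Real.log ‖mat g 0 0‖ * ((1 - ‖orbit g‖ ^ 2) ^ ((3 : ℝ) / 2) * sph 1 g) ∂(nu haarCircle))
          / (∫ g, (1 - ‖orbit g‖ ^ 2) ^ ((3 : ℝ) / 2) * sph 1 g ∂(nu haarCircle)))
        * ((∫ g, ‖orbit g‖ ^ 2 * ((1 - ‖orbit g‖ ^ 2) ^ ((3 : ℝ) / 2) * sph 1 g) ∂(nu haarCircle))
          / (∫ g, (1 - ‖orbit g‖ ^ 2) ^ ((3 : ℝ) / 2) * sph 1 g ∂(nu haarCircle)))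
      = 4 / 9
        * ((∫ g, Real.log ‖mat g 0 0‖ * ((1 - ‖orbit g‖ ^ 2) ^ ((3 : ℝ) / 2) * sph 1 g) ∂(nu haarCircle))
            / (∫ g, (1 - ‖orbit g‖ ^ 2) ^ ((3 : ℝ) / 2) * sph 1 g ∂(nu haarCircle))
          - (∫ g, Real.log ‖mat g 0 0‖ * ((1 - ‖orbit g‖ ^ 2) ^ ((3 + 2 : ℝ) / 2) * sph 1 g)
              ∂(nu haarCircle))
            / (∫ g, (1 - ‖orbit g‖ ^ 2) ^ ((3 + 2 : ℝ) / 2) * sph 1 g ∂(nu haarCircle))) := by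
  rw [covariance_phase_orbit_sq_three (by norm_num) (by norm_num)]
  norm_num

/-- **At `λ = 0`: `Cov_{3,0}(log|a|, |g·0|²) = 2/9`.** -/
theorem covariance_phase_orbit_sq_three_zero :
    (∫ g, Real.log ‖mat g 0 0‖ * ‖orbit g‖ ^ 2 * ((1 - ‖orbit g‖ ^ 2) ^ ((3 : ℝ) / 2) * sph 0 g)
          ∂(nu haarCircle))
        / (∫ g, (1 - ‖orbit g‖ ^ 2) ^ ((3 : ℝ) / 2) * sph 0 g ∂(nu haarCircle))
      - ((∫ g, Real.log ‖mat g 0 0‖ * ((1 - ‖orbit g‖ ^ 2) ^ ((3 : ℝ) / 2) * sph 0 g) ∂(nu haarCircle))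
          / (∫ g, (1 - ‖orbit g‖ ^ 2) ^ ((3 : ℝ) / 2) * sph 0 g ∂(nu haarCircle)))
        * ((∫ g, ‖orbit g‖ ^ 2 * ((1 - ‖orbit g‖ ^ 2) ^ ((3 : ℝ) / 2) * sph 0 g) ∂(nu haarCircle))
          / (∫ g, (1 - ‖orbit g‖ ^ 2) ^ ((3 : ℝ) / 2) * sph 0 g ∂(nu haarCircle)))
      = 2 / 9 := by
  rw [covariance_phase_orbit_sq_zero (by norm_num)]
  norm_num

/-- **At `λ = 0`: the correlation coefficient is `ρ_3(0) = √5/3`.** -/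
theorem correlation_phase_orbit_sq_three_zero :
    ((∫ g, Real.log ‖mat g 0 0‖ * ‖orbit g‖ ^ 2 * ((1 - ‖orbit g‖ ^ 2) ^ ((3 : ℝ) / 2) * sph 0 g)
            ∂(nu haarCircle))
          / (∫ g, (1 - ‖orbit g‖ ^ 2) ^ ((3 : ℝ) / 2) * sph 0 g ∂(nu haarCircle))
        - ((∫ g, Real.log ‖mat g 0 0‖ * ((1 - ‖orbit g‖ ^ 2) ^ ((3 : ℝ) / 2) * sph 0 g) ∂(nu haarCircle))
            / (∫ g, (1 - ‖orbit g‖ ^ 2) ^ ((3 : ℝ) / 2) * sph 0 g ∂(nu haarCircle)))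
          * ((∫ g, ‖orbit g‖ ^ 2 * ((1 - ‖orbit g‖ ^ 2) ^ ((3 : ℝ) / 2) * sph 0 g) ∂(nu haarCircle))
            / (∫ g, (1 - ‖orbit g‖ ^ 2) ^ ((3 : ℝ) / 2) * sph 0 g ∂(nu haarCircle))))
      / Real.sqrt
        (((∫ g, Real.log ‖mat g 0 0‖ ^ 2 * ((1 - ‖orbit g‖ ^ 2) ^ ((3 : ℝ) / 2) * sph 0 g) ∂(nu haarCircle))
            / (∫ g, (1 - ‖orbit g‖ ^ 2) ^ ((3 : ℝ) / 2) * sph 0 g ∂(nu haarCircle))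
          - ((∫ g, Real.log ‖mat g 0 0‖ * ((1 - ‖orbit g‖ ^ 2) ^ ((3 : ℝ) / 2) * sph 0 g) ∂(nu haarCircle))
            / (∫ g, (1 - ‖orbit g‖ ^ 2) ^ ((3 : ℝ) / 2) * sph 0 g ∂(nu haarCircle))) ^ 2)
        * ((∫ g, (‖orbit g‖ ^ 2) ^ 2 * ((1 - ‖orbit g‖ ^ 2) ^ ((3 : ℝ) / 2) * sph 0 g) ∂(nu haarCircle))
            / (∫ g, (1 - ‖orbit g‖ ^ 2) ^ ((3 : ℝ) / 2) * sph 0 g ∂(nu haarCircle))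
          - ((∫ g, ‖orbit g‖ ^ 2 * ((1 - ‖orbit g‖ ^ 2) ^ ((3 : ℝ) / 2) * sph 0 g) ∂(nu haarCircle))
            / (∫ g, (1 - ‖orbit g‖ ^ 2) ^ ((3 : ℝ) / 2) * sph 0 g ∂(nu haarCircle))) ^ 2))
      = Real.sqrt 5 / 3 := by
  rw [correlation_phase_orbit_sq_zero (by norm_num)]
  rw [show (1 : ℝ) - 4 / 3 ^ 2 = 5 / 9 by norm_num, Real.sqrt_div' _ (by norm_num : (0 : ℝ) ≤ 9),
    show (9 : ℝ) = 3 ^ 2 by norm_num, Real.sqrt_sq (by norm_num : (0 : ℝ) ≤ 3)]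

end measure

end Summit.Ventures.HodgeRepro2.T5SU11WeightThreeDossierVI
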